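import Summits.Ventures.HSemireg.WedgeHankelRecurrenceGaussJacobiDiscriminant

/-!
# Venture HSemireg — **THE ULTRASPHERICAL RECURRENCE ON THE FULL CLASSICAL RANGE `λ > −½`, `λ ≠ 0`**: the Gegenbauer data `a ≡ 0`, `b_{n+1} = (n+1)(n+2λ)∕(4(n+1+λ)(n+λ))` ARE the
# Jacobi data of N402 with `α = β = λ − ½`, so the general `(α, β)` theorems of N402 ∕ N411 ∕ N412 give, now for every `λ > −½`, `λ ≠ 0` (N390 ∕ N392 assumed `λ > 0`):
# **all zeros in `(−1, 1)`**, the structure relation **`(X² − 1) q_{n+1}′ = (n+1) X q_{n+1} − 2(n+1+λ) b_{n+1} q_n`**, the differential equation **`(X²−1) q_n″ + (2λ+1) X q_n′ − n(n+2λ) q_n = 0`**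
# and STIELTJES' equilibrium **`Σ_{j≠k} 1∕(x_k − x_j) = (2λ+1) x_k ∕ (2(1 − x_k²))`**

HONEST FRAMING. Part of the Lean index of the computation cell `pub-hsemireg` (seat p10 gen 47, Sunday typer «UNIFORM-IN-n»).  Rational identities and polynomial algebra over `ℝ` only; no variety,
no cohomology theory, no sheaf, no Ext group and no semiregularity map is constructed here; nothing here says that HC / HC_CM / HC_AV holds; no Literature fact (unproved `Prop`) is declared or used.
Custodian versions as in `WedgeHankelSiegelIdeal` (1/3).
SOURCES (cited).  G. Szegő, *Orthogonal Polynomials*, §4.7 (`P_n^{(λ)}` as the Jacobi case `α = β = λ − ½`, eq. (4.7.1)), (4.7.27) (structure relation), (4.7.5) (differential equation), Thm 6.7.1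
∕ §6.7 (Stieltjes); the recurrence (4.7.17) read monic.
PROOF TYPED HERE.  Verification that the Gegenbauer `a, b` satisfy N402's four hypotheses with `α = β = λ − ½` (`a_0 = a_n = 0`, `b_1 = 1∕(2(1+λ))`, the generic `b_{n+2}`; `λ ≠ 0` enters only through
N390's cancelled formula for `b_1`), then N402 `jacobi_zeros_mem`, N411 `jacobi_structure_relation`, N412 `jacobi_differential_equation ∕ jacobi_zeros_electrostatic` specialised.
DEDUP DISCLOSURE (`rg -n 'gegenbauer_' Summits/Ventures/HSemireg/WedgeHankelRecurrenceGauss*`, 2026-09-04): N390 `gegenbauer_zeros_mem ∕ gegenbauer_zeros`, N392 `gegenbauer_structure_relation ∕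
_differential_equation ∕ _zeros_electrostatic`, N394 ∕ N396 ∕ N398 — all under `0 < λ`; the primed names below (range `−½ < λ`, `λ ≠ 0`) are new: 0 hits.

WHAT IS IN THE TREE.  N402 `jacobi_zeros_mem`; N411 `jacobi_structure_relation`; N412 `jacobi_differential_equation`, `jacobi_zeros_electrostatic`.
THIS FILE (namespace `Summit.Ventures.HSemireg.Wedge.HankelOuter` continued; CHAINED on N413 (import only); 0 definitions):
* §1179 `gegenbauer_jacobi_data` (the four Jacobi hypotheses at `α = β = λ − ½`), **`gegenbauer_zeros_mem'`**, **`gegenbauer_structure_relation'`**, **`gegenbauer_differential_equation'`**,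
  **`gegenbauer_zeros_electrostatic'`** (all for `−½ < λ`, `λ ≠ 0`).
CAVEATS.  `λ = 0` (Chebyshev `T`, `b_1 = ½`) is excluded: N390's formula gives `b_1 = 0∕0`; it is treated separately in the lineage (N3xx Chebyshev leaves).  Nothing Ext-side.  New names only.
-/

open Module Polynomial
open scoped Matrix Polynomial

namespace Summit.Ventures.HSemireg.Wedge.HankelOuter

/-! ## §1179. Gegenbauer as Jacobi `α = β = λ − ½` on `λ > −½` -/

/-- **The Gegenbauer recurrence data are the Jacobi data with `α = β = λ − ½`** (`λ > −½`, `λ ≠ 0`). [Szegő (4.7.1), (4.7.17); this file, §1179] -/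
theorem gegenbauer_jacobi_data {a b : ℕ → ℝ} {lam : ℝ} (ha : ∀ n, a n = 0)
    (hb : ∀ n, b (n + 1) = ((n : ℝ) + 1) * ((n : ℝ) + 2 * lam) / (4 * ((n : ℝ) + 1 + lam) * ((n : ℝ) + lam))) (hlam : -1 / 2 < lam) (hlam0 : lam ≠ 0) :
    a 0 = ((lam - 1 / 2) - (lam - 1 / 2)) / ((lam - 1 / 2) + (lam - 1 / 2) + 2) ∧
      (∀ n : ℕ, a (n + 1) = ((lam - 1 / 2) ^ 2 - (lam - 1 / 2) ^ 2) / ((2 * n + 2 + ((lam - 1 / 2) + (lam - 1 / 2))) * (2 * n + 4 + ((lam - 1 / 2) + (lam - 1 / 2))))) ∧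
      b 1 = 4 * (1 + (lam - 1 / 2)) * (1 + (lam - 1 / 2)) / (((lam - 1 / 2) + (lam - 1 / 2) + 2) ^ 2 * ((lam - 1 / 2) + (lam - 1 / 2) + 3)) ∧
      ∀ n : ℕ, b (n + 2) = 4 * ((n : ℝ) + 2) * ((n : ℝ) + 2 + (lam - 1 / 2)) * ((n : ℝ) + 2 + (lam - 1 / 2)) * ((n : ℝ) + 2 + ((lam - 1 / 2) + (lam - 1 / 2))) /
        ((2 * n + 3 + ((lam - 1 / 2) + (lam - 1 / 2))) * (2 * n + 4 + ((lam - 1 / 2) + (lam - 1 / 2))) ^ 2 * (2 * n + 5 + ((lam - 1 / 2) + (lam - 1 / 2)))) := by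
  refine ⟨by rw [ha, sub_self, zero_div], fun n => by rw [ha, sub_self, zero_div], ?_, fun n => ?_⟩
  · have h := hb 0
    push_cast at h
    simp only [zero_add] at h
    rw [h]
    have h1 : 1 + lam ≠ 0 := by linarith
    have h2 : 2 * lam + 1 ≠ 0 := by linarith
    rw [div_eq_div_iff (by positivity) (by
      have : (lam - 1 / 2 + (lam - 1 / 2) + 2) = 2 * lam + 1 := by ring
      rw [this]; exact mul_ne_zero (pow_ne_zero 2 h2) (by linarith))]
    ring
  · rw [show n + 2 = (n + 1) + 1 from rfl, hb (n + 1)]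
    push_cast
    have h0 : (0 : ℝ) ≤ n := Nat.cast_nonneg n
    have h1 : 4 * ((n : ℝ) + 1 + 1 + lam) * ((n : ℝ) + 1 + lam) ≠ 0 := by
      have : 0 < (n : ℝ) + 1 + lam := by linarith
      have : 0 < (n : ℝ) + 1 + 1 + lam := by linarith
      positivity
    have h2 : (2 * (n : ℝ) + 3 + (lam - 1 / 2 + (lam - 1 / 2))) * (2 * (n : ℝ) + 4 + (lam - 1 / 2 + (lam - 1 / 2))) ^ 2 * (2 * (n : ℝ) + 5 + (lam - 1 / 2 + (lam - 1 / 2))) ≠ 0 := by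
      have : 0 < 2 * (n : ℝ) + 3 + (lam - 1 / 2 + (lam - 1 / 2)) := by linarith
      have : 0 < 2 * (n : ℝ) + 4 + (lam - 1 / 2 + (lam - 1 / 2)) := by linarith
      have : 0 < 2 * (n : ℝ) + 5 + (lam - 1 / 2 + (lam - 1 / 2)) := by linarith
      positivity
    rw [div_eq_div_iff h1 h2]
    ring

/-- **ALL ZEROS OF `P_{t+1}^{(λ)}` LIE IN `(−1, 1)` FOR EVERY `λ > −½`, `λ ≠ 0`** (N390 had `λ > 0`). [Szegő Thm 3.3.1 ∕ §4.7; this file, §1179] -/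
theorem gegenbauer_zeros_mem' {q : ℕ → ℝ[X]} {a b : ℕ → ℝ} {lam : ℝ} (hq0 : q 0 = 1) (hq1 : q 1 = Polynomial.X - C (a 0))
    (hrec : ∀ n, q (n + 2) = (Polynomial.X - C (a (n + 1))) * q (n + 1) - C (b (n + 1)) * q n) (ha : ∀ n, a n = 0)
    (hb : ∀ n, b (n + 1) = ((n : ℝ) + 1) * ((n : ℝ) + 2 * lam) / (4 * ((n : ℝ) + 1 + lam) * ((n : ℝ) + lam))) (hlam : -1 / 2 < lam) (hlam0 : lam ≠ 0) (hb0 : 0 < b 0)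
    (t : ℕ) : ∀ s, (q (t + 1)).eval s = 0 → -1 < s ∧ s < 1 := by
  obtain ⟨h0, h1, h2, h3⟩ := gegenbauer_jacobi_data ha hb hlam hlam0
  exact jacobi_zeros_mem hq0 hq1 hrec (by linarith) (by linarith) h0 h1 h2 h3 hb0 t

/-- **THE ULTRASPHERICAL STRUCTURE RELATION ON `λ > −½`, `λ ≠ 0`: `(X² − 1) q_{n+1}′ = (n+1) X q_{n+1} − 2(n+1+λ) b_{n+1} q_n`** (`2(n+1+λ) b_{n+1} = (n+1)(n+2λ)∕(2(n+λ))`, N392's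
coefficient). [Szegő (4.7.27); this file, §1179] -/
theorem gegenbauer_structure_relation' {q : ℕ → ℝ[X]} {a b : ℕ → ℝ} {lam : ℝ} (hq0 : q 0 = 1) (hq1 : q 1 = Polynomial.X - C (a 0))
    (hrec : ∀ n, q (n + 2) = (Polynomial.X - C (a (n + 1))) * q (n + 1) - C (b (n + 1)) * q n) (ha : ∀ n, a n = 0)
    (hb : ∀ n, b (n + 1) = ((n : ℝ) + 1) * ((n : ℝ) + 2 * lam) / (4 * ((n : ℝ) + 1 + lam) * ((n : ℝ) + lam))) (hlam : -1 / 2 < lam) (hlam0 : lam ≠ 0) (n : ℕ) :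
    (Polynomial.X ^ 2 - 1) * derivative (q (n + 1)) = C ((n : ℝ) + 1) * Polynomial.X * q (n + 1) - C (2 * ((n : ℝ) + 1 + lam) * b (n + 1)) * q n := by
  obtain ⟨h0, h1, h2, h3⟩ := gegenbauer_jacobi_data ha hb hlam hlam0
  rw [jacobi_structure_relation hq0 hq1 hrec (by linarith) (by linarith) h0 h1 h2 h3 n, sub_self, mul_zero, zero_div, map_zero, add_zero]
  congr 3
  ring

/-- **THE ULTRASPHERICAL DIFFERENTIAL EQUATION ON `λ > −½`, `λ ≠ 0`: `(X² − 1) q_n″ + (2λ + 1) X q_n′ − n(n + 2λ) q_n = 0`.** [Szegő (4.7.5); this file, §1179] -/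
theorem gegenbauer_differential_equation' {q : ℕ → ℝ[X]} {a b : ℕ → ℝ} {lam : ℝ} (hq0 : q 0 = 1) (hq1 : q 1 = Polynomial.X - C (a 0))
    (hrec : ∀ n, q (n + 2) = (Polynomial.X - C (a (n + 1))) * q (n + 1) - C (b (n + 1)) * q n) (ha : ∀ n, a n = 0)
    (hb : ∀ n, b (n + 1) = ((n : ℝ) + 1) * ((n : ℝ) + 2 * lam) / (4 * ((n : ℝ) + 1 + lam) * ((n : ℝ) + lam))) (hlam : -1 / 2 < lam) (hlam0 : lam ≠ 0) (n : ℕ) :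
    (Polynomial.X ^ 2 - 1) * derivative (derivative (q n)) + C (2 * lam + 1) * Polynomial.X * derivative (q n) - C ((n : ℝ) * ((n : ℝ) + 2 * lam)) * q n = 0 := by
  obtain ⟨h0, h1, h2, h3⟩ := gegenbauer_jacobi_data ha hb hlam hlam0
  have h := jacobi_differential_equation hq0 hq1 hrec (by linarith) (by linarith) h0 h1 h2 h3 n
  rw [sub_self, map_zero, add_zero, show lam - 1 / 2 + (lam - 1 / 2) + 2 = 2 * lam + 1 by ring, show (n : ℝ) + 1 + (lam - 1 / 2 + (lam - 1 / 2)) = (n : ℝ) + 2 * lam by ring] at h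
  exact h

/-- **STIELTJES' EQUILIBRIUM ON `λ > −½`, `λ ≠ 0`: `Σ_{j≠k} 1∕(x_k − x_j) = (2λ + 1) x_k ∕ (2(1 − x_k²))`** at the zeros of `P_{t+1}^{(λ)}`. [Stieltjes 1885; Szegő Thm 6.7.1; this file, §1179] -/
theorem gegenbauer_zeros_electrostatic' {q : ℕ → ℝ[X]} {a b : ℕ → ℝ} {lam : ℝ} (hq0 : q 0 = 1) (hq1 : q 1 = Polynomial.X - C (a 0))
    (hrec : ∀ n, q (n + 2) = (Polynomial.X - C (a (n + 1))) * q (n + 1) - C (b (n + 1)) * q n) (ha : ∀ n, a n = 0)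
    (hb : ∀ n, b (n + 1) = ((n : ℝ) + 1) * ((n : ℝ) + 2 * lam) / (4 * ((n : ℝ) + 1 + lam) * ((n : ℝ) + lam))) (hlam : -1 / 2 < lam) (hlam0 : lam ≠ 0)
    {t : ℕ} {x : Fin (t + 1) → ℝ} (hx : StrictMono x) (hxq : q (t + 1) = ∏ k, (Polynomial.X - C (x k))) (hmem : ∀ k, -1 < x k ∧ x k < 1) (k : Fin (t + 1)) :
    ∑ j ∈ Finset.univ.erase k, (x k - x j)⁻¹ = (2 * lam + 1) * x k / (2 * (1 - x k ^ 2)) := by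
  obtain ⟨h0, h1, h2, h3⟩ := gegenbauer_jacobi_data ha hb hlam hlam0
  rw [jacobi_zeros_electrostatic hq0 hq1 hrec (by linarith) (by linarith) h0 h1 h2 h3 hx hxq hmem k, sub_self, add_zero, show lam - 1 / 2 + (lam - 1 / 2) + 2 = 2 * lam + 1 by ring]

end Summit.Ventures.HSemireg.Wedge.HankelOuter
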